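import Literature.Geometry.Kaehler.ComplexTorusMumfordTateGroupHodgeCircleSigmaPi
import HarnessLib

/-!
# The Mumford–Tate group of `E_{τ₁}^{n₁} × ⋯ × E_{τ_r}^{n_r}` for pairwise non-isogenous CM elliptic curves, real points:
# `MT(ℝ) = {diag(1_{n_ν} ⊗ h_ν(z_ν)) : |z_ν| = |z_μ| ≠ 0}`, `Hg(ℝ) = {diag(1_{n_ν} ⊗ h_ν(e^{iθ_ν}))}`, `MT < ∏ MT` iff `r ≥ 2`,
# `MT = h(ℂ^×)` iff `r = 1` (Gordon 1997, §2.3 Lemma (iii), §3 Theorem; Imai 1976, §3; Moonen 2004, (4.6), (4.10), (5.2))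

Layer `Literature/Geometry/Kaehler`, namespace `Literature.Geometry.Kaehler.ComplexTorus`; lane `lit-hodgefound` (Track 2
foundations library, Layer A3/A4 «Mumford–Tate groups of products; CM tori»), prover seat p17, generation 34, self-proposed row
g34-#4 (rider to g34-#2 / g34-#3): the three `sigmaPiPeriod` structure theorems of this series READ ON GORDON'S CARRIER
`∏_ν E_{τ_ν}^{n_ν} = sigmaPiPeriod fun ν ↦ powPeriod (ellipticPeriod (hτ ν)) (n ν)` («`A = E₁^{n₁} × ⋯ × E_r^{n_r}`», pairwise
non-isogenous CM curves, `n_ν ≥ 1`), with the diagonal complex structure made explicit: `h_{E^{n}}(z) = 1ₙ ⊗ h_E(z)`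
(`hodgeS_powPeriod`, `hodgeCircle_powPeriod`).  Everything BY NAME: the powers are tori on the Hodge-circle locus (g34-#2's
`coe_hodgeGroup_ellipticPow_eq_range_of_quadratic`), `Hom(E_ν^{n_ν}, E_μ^{n_μ}) = 0` for `ν ≠ μ` (`homRat_powPeriod_eq_bot_of_ne`),
`Hg(∏) = ∏ Hg` on elements (g33-#5's `mem_hodgeGroup_sigmaPiPeriod_iff_exists_of_coe_eq_range_of_pairwise_homRat_eq_bot`), the
multiplier relation / the split Mumford–Tate group / `MT ∩ SL = Hg` / the one-class criterion (g34-#3,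
`ComplexTorusMumfordTateGroupHodgeCircleSigmaPi`), and «`Hom(E^{n}, E'^{m}) = 0 ⟺ E ≁ E'`» (g33-#8's
`homRat_eq_bot_iff_not_isIsogenous_ellipticPeriod_of_isIsogenous_ellipticPow`).
THEOREMS ONLY: no definition, no instance, no named fact, nothing conditional (D-0026, net debt 0).

## Sources, verbatim

* B. B. Gordon, *A survey of the Hodge conjecture for abelian varieties* (1997), §2.3 Lemma (iii): «`MT(A) = 𝔾_m · Hg(A)`» (almost
  direct product); §3 Theorem: «Let `A = E₁^{n₁} × ⋯ × E_r^{n_r}` where the `Eᵢ` are pairwise non-isogenous elliptic curves. Then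
  … `Hg(A) = Hg(E₁) × ⋯ × Hg(E_r)`» (each `Hg(Eᵢ)` acting diagonally on `H¹(Eᵢ)^{nᵢ}`; `Hg(Eᵢ) = U(1)` for CM curves).
* H. Imai (1976), §3 Remarks (p. 370 L31–L38): «`Hg(∏_{i,j} Eᵢ^{(j)}) ≅ ∏ᵢ Δ_{mᵢ}(Hg(Eᵢ))`», `Δ_m(H)` = the diagonal subgroup of
  `H^m` (p. 370 L22–L25).
* B. Moonen, *An introduction to Mumford–Tate groups* (2004), §4 (4.6) Lemma («`MT(V₁ ⊕ V₂) ⊂ MT(V₁) × MT(V₂)`»), (4.10)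
  Exercise («`MT(Vⁿ) = MT(V)` … through its diagonal action»), §5 (5.2) («`MT ⊂ 𝔾_m · (Hg(V₁) × Hg(V₂))` … the central factor
  `𝔾_m` is counted twice»).
* J. Carlson, S. Müller-Stach, C. Peters (2017), §15.2 Problem 15.2.3 (a)–(c) (fibre product over `𝔾_m`; powers; any number of
  summands), Examples 15.2.4 (ii) («`MT(H¹(C)) = U(1) · 𝔾_m`» for a CM curve).
* B. Moonen, Yu. Zarhin (1999), §1 («`Hg(Y^{m}) ≅ Hg(Y)`»), §3 Corollary; D. Lombardo (2019), §2.2 cases 5, 6; H. Lange (2023),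
  §7.2.1 Remark 7.2.2 (2), §7.2.3 Prop. 7.2.6.

## What is proved (`E_ν = E_{τ_ν}`, `τ_ν² + a_ντ_ν + b_ν = 0` over `ℚ`, `E_ν ≁ E_μ` for `ν ≠ μ`, `n_ν ≥ 1`; real points)

* §1 FOR ANY elliptic curves: **`MT(∏_ν E_ν^{n_ν})(ℝ) < ∏_ν MT(E_ν^{n_ν})(ℝ)` as soon as `R` has two indices**
  (`mumfordTateGroup_sigmaPi_ellipticPow_lt_of_ne`; the multiplier relation of g34-#3 §1).
* §2 CM CURVES (no isogeny hypothesis): every `M ∈ MT(∏_ν E_ν^{n_ν})(ℝ)` is **`diag(1_{n_ν} ⊗ h_ν(z_ν))` with `z_ν ≠ 0`,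
  `|z_ν| = |z_μ|`** (`exists_eq_blockDiagonal'_kronecker_hodgeS_of_mem_mumfordTateGroup_sigmaPi_ellipticPow`); `MT(ℝ)` is commutative.
* §3 PAIRWISE NON-ISOGENOUS CM CURVES (Gordon's `A`): **`P ∈ Hg(A)(ℝ) ⟺ P = diag(1_{n_ν} ⊗ h_ν(e^{iθ_ν}))`**
  (`mem_hodgeGroup_sigmaPi_ellipticPow_iff`, Gordon §3 / Imai §3 on elements); **`M ∈ MT(A)(ℝ) ⟺ M = diag(1_{n_ν} ⊗ h_ν(z_ν))`,
  `|z_ν| = |z_μ| ≠ 0`** (`mem_mumfordTateGroup_sigmaPi_ellipticPow_iff`: `MT(A) = 𝔾_m · Hg(A)`, the torus `𝔾_m · U(1)^r` of rank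
  `r + 1`); every sign vector `diag(±1)` lies in `MT(A)(ℝ)`; **`MT(A)(ℝ) ∩ SL = Hg(A)(ℝ)`**.
* §4 **`MT(A)(ℝ) = h(ℂ^×)` ⟺ `r = 1`** (`coe_mumfordTateGroup_sigmaPi_ellipticPow_eq_range_hodgeSGL_iff_subsingleton`, `…_iff_card_eq_one`),
  and for CM curves without the isogeny hypothesis **`MT(∏_ν E_ν^{n_ν})(ℝ) = h(ℂ^×)` ⟺ all `E_ν` are isogenous**
  (`coe_mumfordTateGroup_sigmaPi_ellipticPow_eq_range_hodgeSGL_iff_forall_isIsogenous`).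

## References

* [Gordon1997] B. B. Gordon (1997), §2.3 Lemma (iii), §3 Theorem. [cite: Gordon1997, §2.3 Lemma (iii) and §3 Theorem]
* [Imai1976HodgeGroups] H. Imai (1976), §3 Remarks (p. 370). [cite: Imai1976HodgeGroups, §3 Remarks (p. 370 L22–L25, L31–L38)]
* [Moonen2004MT] B. Moonen (2004), §4 (4.6) Lemma, (4.10) Exercise, §5 (5.2). [cite: Moonen2004MT, §4 Lemma 4.6, Exercise 4.10 and §5 (5.2)]
* [CarlsonMullerStachPeters2017] J. Carlson, S. Müller-Stach, C. Peters (2017), §15.2 Problem 15.2.3, Examples 15.2.4 (ii).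
  [cite: CarlsonMullerStachPeters2017, §15.2 Problem 15.2.3 (a)–(c) and Examples 15.2.4 (ii)]
* [MoonenZarhin1999LowDim] B. Moonen, Yu. Zarhin (1999), §1, §3 Corollary. [cite: MoonenZarhin1999LowDim, §1 and §3 Corollary]
* [Lombardo2019] D. Lombardo (2019), §2.2 cases 5, 6. [cite: Lombardo2019, §2.2 cases 5 and 6]
* [Lange2023AbelianVarietiesComplex] H. Lange (2023), §7.2.1 Remark 7.2.2 (2), §7.2.3 Prop. 7.2.6. [cite: Lange2023AbelianVarietiesComplex, §7.2.1 Remark 7.2.2 (2) and §7.2.3 Prop. 7.2.6]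
-/

noncomputable section

open scoped Matrix Real Kronecker

open Function Module Matrix

namespace Literature.Geometry.Kaehler

namespace ComplexTorus

section EllipticPowers

variable {R : Type*} [Fintype R] [DecidableEq R] {τ : R → ℂ} (hτ : ∀ ν, (τ ν).im ≠ 0) (n : R → ℕ)

omit [Fintype R] [DecidableEq R] in
/-- `dim_ℂ ℂ^{n} = n ≥ 1` for the covering space of `E_τⁿ`. [folklore] -/
private theorem finrank_fin_fun_pos'' {ν : R} (hn : 0 < n ν) : 0 < finrank ℂ (Fin (n ν) → ℂ) := by
  rwa [Module.finrank_fin_fun]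

omit [Fintype R] [DecidableEq R] in
/-- `Hom(E_ν^{n_ν}, E_μ^{n_μ}) = 0` for non-isogenous `E_ν ≁ E_μ` (simple factors, Schur). [folklore] -/
private theorem homRat_ellipticPow_eq_bot_of_ne
    (hni : ∀ ν ν', ν ≠ ν' → ¬ IsIsogenous (ellipticPeriod (hτ ν)) (ellipticPeriod (hτ ν'))) {ν μ : R} (h : ν ≠ μ) :
    homRat (powPeriod (ellipticPeriod (hτ ν)) (n ν)) (powPeriod (ellipticPeriod (hτ μ)) (n μ)) = ⊥ :=
  homRat_powPeriod_eq_bot_of_ne (fun ν ↦ ellipticPeriod (hτ ν)) n (fun ν ↦ isSimple_ellipticPeriod (hτ ν)) hni h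

omit [Fintype R] [DecidableEq R] in
/-- The index `Fin n_ν × Fin 2` of the lattice of `E_ν^{n_ν}` is non-empty for `n_ν ≥ 1`. [folklore] -/
private theorem nonempty_fin_prod_fin_two {ν : R} (hn : 0 < n ν) : Nonempty (Fin (n ν) × Fin 2) := ⟨(⟨0, hn⟩, 0)⟩

/-! ## §1 Any elliptic curves: `MT(∏_ν E_ν^{n_ν})(ℝ) < ∏_ν MT(E_ν^{n_ν})(ℝ)` for two indices -/

/-- **`MT(E_{τ₁}^{n₁} × ⋯ × E_{τ_r}^{n_r})(ℝ) < MT(E_{τ₁}^{n₁})(ℝ) × ⋯ × MT(E_{τ_r}^{n_r})(ℝ)` AS SOON AS THERE ARE TWO INDICES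
`ν ≠ μ`** (`n_ν, n_μ ≥ 1`; ANY elliptic curves, CM or not, isogenous or not): the element `diag(2·1, 1, …, 1)` of the product
violates the multiplier relation `det(M_νν)^{2n_μ} = det(M_μμ)^{2n_ν}` of g34-#3 — «the central factor `𝔾_m` is counted twice».
[cite: Moonen2004MT, §4 Lemma 4.6 and §5 (5.2)] [cite: CarlsonMullerStachPeters2017, §15.2 Problem 15.2.3 (a)–(c)]
[cite: Lombardo2019, §2.2 cases 5 and 6] -/
theorem mumfordTateGroup_sigmaPi_ellipticPow_lt_of_ne {ν μ : R} (hνμ : ν ≠ μ) (hν : 0 < n ν) (hμ : 0 < n μ) :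
    mumfordTateGroup (sigmaPiPeriod fun ν ↦ powPeriod (ellipticPeriod (hτ ν)) (n ν)) <
      (Subgroup.pi Set.univ fun ν ↦ mumfordTateGroup (powPeriod (ellipticPeriod (hτ ν)) (n ν))).map
        (sigmaBlockDiagGL (fun ν ↦ Fin (n ν) × Fin 2) ℝ) := by
  haveI := nonempty_fin_prod_fin_two n hν
  haveI := nonempty_fin_prod_fin_two n hμ
  exact mumfordTateGroup_sigmaPi_lt_of_ne (fun ν ↦ powPeriod (ellipticPeriod (hτ ν)) (n ν)) hνμ

/-! ## §2 CM curves: `M = diag(1_{n_ν} ⊗ h_ν(z_ν))`, `|z_ν| = |z_μ| ≠ 0` -/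

/-- **CM CURVES `E_{τ_ν}` (`τ_ν` QUADRATIC OVER `ℚ`), `n_ν ≥ 1`, NO ISOGENY HYPOTHESIS: every `M ∈ MT(∏_ν E_ν^{n_ν})(ℝ)` is
`diag(1_{n_ν} ⊗ h_ν(z_ν))_ν` with `z_ν ≠ 0` and `|z_ν| = |z_μ|`** — the powers `E_ν^{n_ν}` are tori on the Hodge-circle locus with
`h_{E^{n}}(z) = 1ₙ ⊗ h_E(z)` (the diagonal Hodge structure `H₁(Eⁿ) = H₁(E)ⁿ`), and g34-#3 §2 applies.
[cite: Moonen2004MT, §4 Lemma 4.6, Exercise 4.10 and §5 (5.2)] [cite: CarlsonMullerStachPeters2017, §15.2 Problem 15.2.3 (a)–(c) and Examples 15.2.4 (ii)]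
[cite: Imai1976HodgeGroups, §3 Remarks (p. 370 L22–L25, L31–L38)] -/
theorem exists_eq_blockDiagonal'_kronecker_hodgeS_of_mem_mumfordTateGroup_sigmaPi_ellipticPow
    (hq : ∀ ν, ∃ a b : ℚ, τ ν ^ 2 + a * τ ν + b = 0) (hn : ∀ ν, 0 < n ν) {M : GL (Σ ν, Fin (n ν) × Fin 2) ℝ}
    (hM : M ∈ mumfordTateGroup (sigmaPiPeriod fun ν ↦ powPeriod (ellipticPeriod (hτ ν)) (n ν))) :
    ∃ z : R → ℂ, (∀ ν, z ν ≠ 0) ∧ (∀ ν μ, ‖z ν‖ = ‖z μ‖) ∧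
      (M : Matrix (Σ ν, Fin (n ν) × Fin 2) (Σ ν, Fin (n ν) × Fin 2) ℝ) =
        Matrix.blockDiagonal' fun ν ↦ (1 : Matrix (Fin (n ν)) (Fin (n ν)) ℝ) ⊗ₖ hodgeS (ellipticPeriod (hτ ν)) (z ν) := by
  obtain ⟨z, hz, hnorm, hMz⟩ := exists_eq_blockDiagonal'_hodgeS_of_mem_mumfordTateGroup_sigmaPiPeriod
    (fun ν ↦ powPeriod (ellipticPeriod (hτ ν)) (n ν)) (fun ν ↦ finrank_fin_fun_pos'' n (hn ν))
    (coe_hodgeGroup_ellipticPow_eq_range_of_quadratic hτ n hq hn) hM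
  refine ⟨z, hz, hnorm, ?_⟩
  rw [hMz]
  exact congrArg Matrix.blockDiagonal' (funext fun ν ↦ hodgeS_powPeriod (n ν) (ellipticPeriod (hτ ν)) (z ν))

/-- **`MT(∏_ν E_{τ_ν}^{n_ν})(ℝ)` IS COMMUTATIVE for CM curves** (no isogeny hypothesis; «`MT(H¹(C)) = U(1) · 𝔾_m` … is also
abelian» factorwise, and `MT(∏) ⊆ ∏ MT`). [cite: CarlsonMullerStachPeters2017, §15.2 Examples 15.2.4 (ii)]
[cite: Lange2023AbelianVarietiesComplex, §7.2.3 Prop. 7.2.6] -/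
theorem mumfordTateGroup_sigmaPi_ellipticPow_comm_of_quadratic (hq : ∀ ν, ∃ a b : ℚ, τ ν ^ 2 + a * τ ν + b = 0)
    (hn : ∀ ν, 0 < n ν) {M N : GL (Σ ν, Fin (n ν) × Fin 2) ℝ}
    (hM : M ∈ mumfordTateGroup (sigmaPiPeriod fun ν ↦ powPeriod (ellipticPeriod (hτ ν)) (n ν)))
    (hN : N ∈ mumfordTateGroup (sigmaPiPeriod fun ν ↦ powPeriod (ellipticPeriod (hτ ν)) (n ν))) : M * N = N * M :=
  mumfordTateGroup_sigmaPiPeriod_comm_of_coe_eq_range (fun ν ↦ powPeriod (ellipticPeriod (hτ ν)) (n ν))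
    (fun ν ↦ finrank_fin_fun_pos'' n (hn ν)) (coe_hodgeGroup_ellipticPow_eq_range_of_quadratic hτ n hq hn) hM hN

/-! ## §3 Gordon's `A = E₁^{n₁} × ⋯ × E_r^{n_r}`, pairwise non-isogenous CM curves: `Hg(A)(ℝ)` and `MT(A)(ℝ)` on elements -/

/-- **GORDON'S §3 THEOREM / IMAI'S §3 REMARK ON ELEMENTS, CM CASE: `P ∈ Hg(E₁^{n₁} × ⋯ × E_r^{n_r})(ℝ) ⟺
P = diag(1_{n_ν} ⊗ h_ν(e^{iθ_ν}))_ν`** for pairwise non-isogenous CM curves and `n_ν ≥ 1` — «`Hg(A) = Hg(E₁) × ⋯ × Hg(E_r)`»,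
«`Hg(∏_{i,j} Eᵢ^{(j)}) ≅ ∏ᵢ Δ_{mᵢ}(Hg(Eᵢ))`» with `Hg(Eᵢ)(ℝ) = hᵢ(S¹)`. [cite: Gordon1997, §3 Theorem]
[cite: Imai1976HodgeGroups, §3 Remarks (p. 370 L22–L25, L31–L38)] [cite: MoonenZarhin1999LowDim, §1 and §3 Corollary] -/
theorem mem_hodgeGroup_sigmaPi_ellipticPow_iff
    (hni : ∀ ν ν', ν ≠ ν' → ¬ IsIsogenous (ellipticPeriod (hτ ν)) (ellipticPeriod (hτ ν')))
    (hq : ∀ ν, ∃ a b : ℚ, τ ν ^ 2 + a * τ ν + b = 0) (hn : ∀ ν, 0 < n ν)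
    {P : SpecialLinearGroup (Σ ν, Fin (n ν) × Fin 2) ℝ} :
    P ∈ hodgeGroup (sigmaPiPeriod fun ν ↦ powPeriod (ellipticPeriod (hτ ν)) (n ν)) ↔
      ∃ θ : R → ℝ, (P : Matrix (Σ ν, Fin (n ν) × Fin 2) (Σ ν, Fin (n ν) × Fin 2) ℝ) =
        Matrix.blockDiagonal' fun ν ↦ (1 : Matrix (Fin (n ν)) (Fin (n ν)) ℝ) ⊗ₖ hodgeCircle (ellipticPeriod (hτ ν)) (θ ν) := by
  rw [mem_hodgeGroup_sigmaPiPeriod_iff_exists_of_coe_eq_range_of_pairwise_homRat_eq_bot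
    (fun ν ↦ powPeriod (ellipticPeriod (hτ ν)) (n ν)) (fun ν ↦ finrank_fin_fun_pos'' n (hn ν))
    (coe_hodgeGroup_ellipticPow_eq_range_of_quadratic hτ n hq hn) (fun _ _ h ↦ homRat_ellipticPow_eq_bot_of_ne hτ n hni h)]
  have key : ∀ θ : R → ℝ, ((sigmaBlockDiagSL (fun ν ↦ Fin (n ν) × Fin 2) ℝ fun ν ↦
      hodgeCircleSL (powPeriod (ellipticPeriod (hτ ν)) (n ν)) (θ ν) : SpecialLinearGroup (Σ ν, Fin (n ν) × Fin 2) ℝ) :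
        Matrix (Σ ν, Fin (n ν) × Fin 2) (Σ ν, Fin (n ν) × Fin 2) ℝ) =
      Matrix.blockDiagonal' fun ν ↦ (1 : Matrix (Fin (n ν)) (Fin (n ν)) ℝ) ⊗ₖ hodgeCircle (ellipticPeriod (hτ ν)) (θ ν) :=
    fun θ ↦ by
      rw [coe_sigmaBlockDiagSL]
      exact congrArg Matrix.blockDiagonal' (funext fun ν ↦ by
        rw [coe_hodgeCircleSL, hodgeCircle_powPeriod])
  refine exists_congr fun θ ↦ ⟨fun h ↦ by rw [h, key], fun h ↦ Subtype.ext (by rw [h, key])⟩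

/-- **`MT(E₁^{n₁} × ⋯ × E_r^{n_r})(ℝ) = 𝔾_m · Hg`, ON ELEMENTS: `M ∈ MT(A)(ℝ) ⟺ M = diag(1_{n_ν} ⊗ h_ν(z_ν))_ν` with `z_ν ≠ 0`
and `|z_ν| = |z_μ|`** for pairwise non-isogenous CM curves and `n_ν ≥ 1` — the torus `𝔾_m · U(1)^r` of rank `r + 1`, the fibre
product of the `MT(E_ν^{n_ν})(ℝ) = (1_{n_ν} ⊗ h_ν)(ℂ^×)` over `𝔾_m` (g34-#3 §3 on Gordon's carrier).
[cite: Gordon1997, §2.3 Lemma (iii) and §3 Theorem] [cite: CarlsonMullerStachPeters2017, §15.2 Problem 15.2.3 (a)–(c)]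
[cite: Moonen2004MT, §4 Lemma 4.6, Exercise 4.10 and §5 (5.2)] [cite: Lombardo2019, §2.2 case 5] -/
theorem mem_mumfordTateGroup_sigmaPi_ellipticPow_iff
    (hni : ∀ ν ν', ν ≠ ν' → ¬ IsIsogenous (ellipticPeriod (hτ ν)) (ellipticPeriod (hτ ν')))
    (hq : ∀ ν, ∃ a b : ℚ, τ ν ^ 2 + a * τ ν + b = 0) (hn : ∀ ν, 0 < n ν) {M : GL (Σ ν, Fin (n ν) × Fin 2) ℝ} :
    M ∈ mumfordTateGroup (sigmaPiPeriod fun ν ↦ powPeriod (ellipticPeriod (hτ ν)) (n ν)) ↔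
      ∃ z : R → ℂ, (∀ ν, z ν ≠ 0) ∧ (∀ ν μ, ‖z ν‖ = ‖z μ‖) ∧
        (M : Matrix (Σ ν, Fin (n ν) × Fin 2) (Σ ν, Fin (n ν) × Fin 2) ℝ) =
          Matrix.blockDiagonal' fun ν ↦ (1 : Matrix (Fin (n ν)) (Fin (n ν)) ℝ) ⊗ₖ hodgeS (ellipticPeriod (hτ ν)) (z ν) := by
  rw [mem_mumfordTateGroup_sigmaPiPeriod_iff_of_pairwise_homRat_eq_bot (fun ν ↦ powPeriod (ellipticPeriod (hτ ν)) (n ν))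
    (fun ν ↦ finrank_fin_fun_pos'' n (hn ν)) (coe_hodgeGroup_ellipticPow_eq_range_of_quadratic hτ n hq hn)
    (fun _ _ h ↦ homRat_ellipticPow_eq_bot_of_ne hτ n hni h)]
  have key : ∀ z : R → ℂ, (Matrix.blockDiagonal' fun ν ↦ hodgeS (powPeriod (ellipticPeriod (hτ ν)) (n ν)) (z ν)) =
      Matrix.blockDiagonal' fun ν ↦ (1 : Matrix (Fin (n ν)) (Fin (n ν)) ℝ) ⊗ₖ hodgeS (ellipticPeriod (hτ ν)) (z ν) :=
    fun z ↦ congrArg Matrix.blockDiagonal' (funext fun ν ↦ hodgeS_powPeriod (n ν) (ellipticPeriod (hτ ν)) (z ν))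
  refine exists_congr fun z ↦ and_congr_right fun _ ↦ and_congr_right fun _ ↦ ?_
  rw [key]

/-- **Every sign vector `diag(ε_ν · 1)`, `ε_ν = ±1`, lies in `MT(E₁^{n₁} × ⋯ × E_r^{n_r})(ℝ)`** (pairwise non-isogenous CM curves):
for `r ≥ 2` the Mumford–Tate group is NOT `h(ℂ^×)`. [cite: Lombardo2019, §2.2 case 5] [cite: CarlsonMullerStachPeters2017, §15.2 Problem 15.2.3 (a)–(c)] -/
theorem sigmaBlockDiagGL_sign_mem_mumfordTateGroup_sigmaPi_ellipticPow
    (hni : ∀ ν ν', ν ≠ ν' → ¬ IsIsogenous (ellipticPeriod (hτ ν)) (ellipticPeriod (hτ ν')))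
    (hq : ∀ ν, ∃ a b : ℚ, τ ν ^ 2 + a * τ ν + b = 0) (hn : ∀ ν, 0 < n ν) (S : Finset R) :
    sigmaBlockDiagGL (fun ν ↦ Fin (n ν) × Fin 2) ℝ (fun ν ↦ if ν ∈ S then -1 else 1) ∈
      mumfordTateGroup (sigmaPiPeriod fun ν ↦ powPeriod (ellipticPeriod (hτ ν)) (n ν)) :=
  sigmaBlockDiagGL_sign_mem_mumfordTateGroup_sigmaPiPeriod_of_pairwise_homRat_eq_bot
    (fun ν ↦ powPeriod (ellipticPeriod (hτ ν)) (n ν)) (fun ν ↦ finrank_fin_fun_pos'' n (hn ν))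
    (coe_hodgeGroup_ellipticPow_eq_range_of_quadratic hτ n hq hn) (fun _ _ h ↦ homRat_ellipticPow_eq_bot_of_ne hτ n hni h) S

/-- **`MT(E₁^{n₁} × ⋯ × E_r^{n_r})(ℝ) ∩ SL = Hg(E₁^{n₁} × ⋯ × E_r^{n_r})(ℝ)`** (pairwise non-isogenous CM curves, `n_ν ≥ 1`):
`Hg` is the kernel of the multiplier on `MT = 𝔾_m · Hg`, real points. [cite: Gordon1997, §2.3 Lemma (iii)]
[cite: CarlsonMullerStachPeters2017, §15.2 Problem 15.2.3 (a)–(c)] -/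
theorem mem_hodgeGroup_sigmaPi_ellipticPow_iff_toGL_mem_mumfordTateGroup
    (hni : ∀ ν ν', ν ≠ ν' → ¬ IsIsogenous (ellipticPeriod (hτ ν)) (ellipticPeriod (hτ ν')))
    (hq : ∀ ν, ∃ a b : ℚ, τ ν ^ 2 + a * τ ν + b = 0) (hn : ∀ ν, 0 < n ν)
    {P : SpecialLinearGroup (Σ ν, Fin (n ν) × Fin 2) ℝ} :
    P ∈ hodgeGroup (sigmaPiPeriod fun ν ↦ powPeriod (ellipticPeriod (hτ ν)) (n ν)) ↔
      (Matrix.SpecialLinearGroup.toGL P : GL (Σ ν, Fin (n ν) × Fin 2) ℝ) ∈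
        mumfordTateGroup (sigmaPiPeriod fun ν ↦ powPeriod (ellipticPeriod (hτ ν)) (n ν)) :=
  mem_hodgeGroup_sigmaPiPeriod_iff_toGL_mem_mumfordTateGroup_of_pairwise_homRat_eq_bot
    (fun ν ↦ powPeriod (ellipticPeriod (hτ ν)) (n ν)) (fun ν ↦ finrank_fin_fun_pos'' n (hn ν))
    (coe_hodgeGroup_ellipticPow_eq_range_of_quadratic hτ n hq hn) (fun _ _ h ↦ homRat_ellipticPow_eq_bot_of_ne hτ n hni h)

/-! ## §4 `MT(A)(ℝ) = h(ℂ^×)` iff `r = 1`; for CM curves in general iff all `E_ν` are isogenous -/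

/-- **`MT(E₁^{n₁} × ⋯ × E_r^{n_r})(ℝ) = h(ℂ^×)` ⟺ `r = 1`** (pairwise non-isogenous CM curves, `n_ν ≥ 1`, non-empty index): the
Mumford–Tate group is the Deligne torus of ONE CM curve exactly when there is one isogeny class (Lombardo's case 6 vs case 5).
[cite: Lombardo2019, §2.2 cases 5 and 6] [cite: Imai1976HodgeGroups, §3 Remarks (p. 370 L22–L25)]
[cite: Lange2023AbelianVarietiesComplex, §7.2.1 Remark 7.2.2 (2)] -/
theorem coe_mumfordTateGroup_sigmaPi_ellipticPow_eq_range_hodgeSGL_iff_subsingleton [Nonempty R]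
    (hni : ∀ ν ν', ν ≠ ν' → ¬ IsIsogenous (ellipticPeriod (hτ ν)) (ellipticPeriod (hτ ν')))
    (hq : ∀ ν, ∃ a b : ℚ, τ ν ^ 2 + a * τ ν + b = 0) (hn : ∀ ν, 0 < n ν) :
    (mumfordTateGroup (sigmaPiPeriod fun ν ↦ powPeriod (ellipticPeriod (hτ ν)) (n ν)) :
        Set (GL (Σ ν, Fin (n ν) × Fin 2) ℝ)) =
      Set.range (hodgeSGL (sigmaPiPeriod fun ν ↦ powPeriod (ellipticPeriod (hτ ν)) (n ν))) ↔ ∀ ν μ : R, ν = μ := by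
  rw [coe_mumfordTateGroup_sigmaPiPeriod_eq_range_hodgeSGL_iff_forall_homRat_ne_bot
    (fun ν ↦ powPeriod (ellipticPeriod (hτ ν)) (n ν)) (fun ν ↦ finrank_fin_fun_pos'' n (hn ν))
    (coe_hodgeGroup_ellipticPow_eq_range_of_quadratic hτ n hq hn)]
  refine ⟨fun h ν μ ↦ ?_, fun h ν μ hνμ ↦ (hνμ (h ν μ)).elim⟩
  by_contra hνμ
  exact h ν μ hνμ (homRat_ellipticPow_eq_bot_of_ne hτ n hni hνμ)

/-- … **⟺ `#R = 1`**: `MT(E₁^{n₁} × ⋯ × E_r^{n_r}) = h(ℂ^×)` iff `r = 1`. [cite: Lombardo2019, §2.2 cases 5 and 6]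
[cite: Imai1976HodgeGroups, §3 Remarks (p. 370 L22–L25)] -/
theorem coe_mumfordTateGroup_sigmaPi_ellipticPow_eq_range_hodgeSGL_iff_card_eq_one [Nonempty R]
    (hni : ∀ ν ν', ν ≠ ν' → ¬ IsIsogenous (ellipticPeriod (hτ ν)) (ellipticPeriod (hτ ν')))
    (hq : ∀ ν, ∃ a b : ℚ, τ ν ^ 2 + a * τ ν + b = 0) (hn : ∀ ν, 0 < n ν) :
    (mumfordTateGroup (sigmaPiPeriod fun ν ↦ powPeriod (ellipticPeriod (hτ ν)) (n ν)) :
        Set (GL (Σ ν, Fin (n ν) × Fin 2) ℝ)) =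
      Set.range (hodgeSGL (sigmaPiPeriod fun ν ↦ powPeriod (ellipticPeriod (hτ ν)) (n ν))) ↔ Fintype.card R = 1 := by
  rw [coe_mumfordTateGroup_sigmaPi_ellipticPow_eq_range_hodgeSGL_iff_subsingleton hτ n hni hq hn, Fintype.card_eq_one_iff]
  exact ⟨fun h ↦ ⟨Classical.arbitrary R, fun ν ↦ h ν _⟩, fun ⟨x, hx⟩ ν μ ↦ (hx ν).trans (hx μ).symm⟩

/-- **CM CURVES, NO ISOGENY HYPOTHESIS: `MT(∏_ν E_{τ_ν}^{n_ν})(ℝ) = h(ℂ^×)` ⟺ ALL THE `E_{τ_ν}` ARE ISOGENOUS** (`n_ν ≥ 1`,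
non-empty index) — g34-#3's one-class criterion «all `Hom(X_k, X_l) ≠ 0`» with «`Hom(E^{n}, E'^{m}) ≠ 0 ⟺ E ∼ E'`»; then the
product is isogenous to a power of one CM curve and its Mumford–Tate group is that curve's Deligne torus.
[cite: Lombardo2019, §2.2 case 6] [cite: Imai1976HodgeGroups, §3 Remarks (p. 370 L22–L25)] [cite: MoonenZarhin1999LowDim, §1 and §3 Corollary]
[cite: Lange2023AbelianVarietiesComplex, §7.2.1 Remark 7.2.2 (2)] -/
theorem coe_mumfordTateGroup_sigmaPi_ellipticPow_eq_range_hodgeSGL_iff_forall_isIsogenous [Nonempty R]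
    (hq : ∀ ν, ∃ a b : ℚ, τ ν ^ 2 + a * τ ν + b = 0) (hn : ∀ ν, 0 < n ν) :
    (mumfordTateGroup (sigmaPiPeriod fun ν ↦ powPeriod (ellipticPeriod (hτ ν)) (n ν)) :
        Set (GL (Σ ν, Fin (n ν) × Fin 2) ℝ)) =
      Set.range (hodgeSGL (sigmaPiPeriod fun ν ↦ powPeriod (ellipticPeriod (hτ ν)) (n ν))) ↔
        ∀ ν μ : R, IsIsogenous (ellipticPeriod (hτ ν)) (ellipticPeriod (hτ μ)) := by
  rw [coe_mumfordTateGroup_sigmaPiPeriod_eq_range_hodgeSGL_iff_forall_homRat_ne_bot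
    (fun ν ↦ powPeriod (ellipticPeriod (hτ ν)) (n ν)) (fun ν ↦ finrank_fin_fun_pos'' n (hn ν))
    (coe_hodgeGroup_ellipticPow_eq_range_of_quadratic hτ n hq hn)]
  have hiff : ∀ ν μ : R, homRat (powPeriod (ellipticPeriod (hτ ν)) (n ν)) (powPeriod (ellipticPeriod (hτ μ)) (n μ)) = ⊥ ↔
      ¬ IsIsogenous (ellipticPeriod (hτ ν)) (ellipticPeriod (hτ μ)) := fun ν μ ↦ by
    have hk := homRat_eq_bot_iff_not_isIsogenous_ellipticPeriod_of_isIsogenous_ellipticPow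
      (fun ν ↦ powPeriod (ellipticPeriod (hτ ν)) (n ν)) (k := ν) (l := μ) (finrank_fin_fun_pos'' n (hn ν))
      (finrank_fin_fun_pos'' n (hn μ)) (hτ ν) (hτ μ) ((ellipticEnd_ne_bot_iff (hτ ν)).2 (hq ν))
    rw [Module.finrank_fin_fun, Module.finrank_fin_fun] at hk
    exact hk (IsIsogenous.refl _) (IsIsogenous.refl _)
  refine ⟨fun h ν μ ↦ ?_, fun h ν μ _ ↦ (not_iff_not.2 (hiff ν μ)).2 (not_not.2 (h ν μ))⟩
  by_cases hνμ : ν = μ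
  · subst hνμ
    exact IsIsogenous.refl _
  · exact not_not.1 ((not_congr (hiff ν μ)).1 (h ν μ hνμ))

end EllipticPowers

end ComplexTorus

end Literature.Geometry.Kaehler
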